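import Literature.MathematicalPhysics.QuantumFieldTheory.Balaban1983to89.InfiniteVolumeSufficientXXIV
import HarnessLib

/-!
# `InfiniteVolume.LoopProductGrid` — infinite volume, what would suffice (lineage IR-1, module XXV, part 1 of 3):
# additive grid configurations on `ℤ^d` and the character sum killed by a shift

HONEST FRAMING (cell `pub-balaban`, soloist seat IR-1 «what would suffice for (3) INFINITE VOLUME», generation 24; tree target
`Summits/QuantumFields/BalabanUV/InfiniteVolume/` under the LEAN PLACEMENT RULE 2026-08-19: new cell work lives under
`Summits/`, published results only under `Literature/`).  Module XXV of the lineage (parts 1–3: this file,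
`LoopProductVanishing`, `LoopProductThreshold`) proves a KINEMATIC NEGATIVE about which classes of Wilson-loop observables can
determine an infinite-volume lattice gauge state: for `SU(N)`, `N ≥ 3`, products of at most `N - 2` single-loop observables in
arbitrary functions of the holonomies do NOT span the gauge-invariant cylinder observables (part 3, headline
`LoopProductThreshold.not_spansGaugeInvariantCylinders_allProdLoopObsLE_of_le`).  It is elementary finite Fourier analysis on
the `3`-torsion of the maximal torus, kernel-checked; NOT a statement about Bałaban's renormalisation group, NOT infinite-volume
existence, NOT a mass gap, NOT the continuum, NOT Clay.  Value = the census of the missing infinite-volume estimate made sharper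
(cell record `ir/SUFFICIENT.md` §29); NOT summit progress.

ABSOLUTE RULE.  No internally-minted statement may enter as a cited fact.  Every hypothesis is either kernel-proved in this
package or a verbatim quotation of a PUBLISHED theorem with page reference.  The manuscript(s) under audit are NOT citable for
their own disputed steps — they are the thing under adjudication; programme-internal (2001/route/tribunal) claims are never
citable.  In this file NOTHING printed is used as a hypothesis and nothing is cited: every statement is proved from Mathlib and
from the tree's definitions (`LatticeGaugeDLR`, `WilsonLoops`, `GaugeGroupsProofs`, modules XIX, XXII–XXIV of the lineage),
imported BY NAME and not modified.  `[folklore]` throughout.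

WHAT THIS PART PROVES.
* PART A — the characters `χ(a) = ζ_q^a` of `ℤ/q` (`zchar`, on module XXIII's `rootζ`): multiplicativity, `|χ| = 1`,
  `χ(-a) = conj χ(a)`, `χ(a) = 1 ↔ a = 0`, and the one analytic input of module XXV, a CHARACTER SUM KILLED BY A SHIFT
  (`sum_zchar_mul_eq_zero_of_shift`): on a finite abelian group `A`, if `L : A → ℤ/q` is additive, `φ : A → ℂ` is invariant
  under `x ↦ x + x₀` and `L x₀ ≠ 0`, then `Σ_x χ(L x) φ(x) = 0`.
* PART B — the additive parametrisation `D : (ℤ/q)^p → SU(p+1)`, `D(x) = diag(χ(x_0), …, χ(x_{p-1}), χ(-Σ x_i))` (`torDiag`;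
  a homomorphism, `torDiag_add`, by the tree's `diagonal_mem_specialUnitaryGroup_iff`; trace formula `trace_coe_torDiag`).
* PART C — grid configurations (`gridCfg`): for loaded edges `E_j` of `ℤ^d` and variables `s_j` in an abelian group `A`,
  `U_s(e) = D(Σ_j [e = E_j] • s_j)` for any additive-to-multiplicative `D : A → G`; along ANY walk `w` the holonomy is
  `D(Σ_j m_j(w) • s_j)` with the integer winding coefficients `m_j(w) = walkCoeff_{E_j}(w)` (`walkHolonomy_gridCfg` —
  non-loaded edges carry `D(0) = 1`, reversed darts contribute `-1`, and `D` turns sums into products); hence a single-loop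
  observable `U ↦ f(U_ℓ)` takes at `U_s` the value `f(D(Σ_j m_j(ℓ) • s_j))` (`wilsonLoopObs_gridCfg`).

VERSIONS: v1 (gen 24).
-/

namespace Summit.QuantumFields.BalabanUV.InfiniteVolume.LoopProductGrid

open Literature.MathematicalPhysics.QuantumFieldTheory hiding ZdEdge
open Literature.MathematicalPhysics.QuantumLattice
open Literature.Probability.LatticeModels (zdGraph)

/-! ## PART A — THE CHARACTERS `χ(a) = ζ_q^a` OF `ℤ/q`; CHARACTER SUMS KILLED BY A SHIFT -/

section ZChar

variable {q : ℕ}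

/-- The character `χ_q(a) = ζ_q ^ a` of `ℤ/q` (`ζ_q = rootζ q` of module XXIII; the exponent is the canonical
representative `a.val`). [folklore] -/
noncomputable def zchar (q : ℕ) (a : ZMod q) : ℂ := rootζ q ^ a.val

/-- `χ(0) = 1`. [folklore] -/
theorem zchar_zero : zchar q 0 = 1 := by simp [zchar, ZMod.val_zero]

variable [NeZero q]

/-- `χ(a + b) = χ(a) χ(b)` (because `ζ_q ^ q = 1`). [folklore] -/
theorem zchar_add (a b : ZMod q) : zchar q (a + b) = zchar q a * zchar q b := by
  simp only [zchar]
  rw [ZMod.val_add, ← pow_eq_pow_mod _ (rootζ_pow_self (NeZero.ne q)), pow_add]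

/-- `|χ(a)| = 1`. [folklore] -/
theorem norm_zchar (a : ZMod q) : ‖zchar q a‖ = 1 := norm_rootζ_pow (NeZero.ne q) _

/-- `χ(a) ≠ 0`. [folklore] -/
theorem zchar_ne_zero (a : ZMod q) : zchar q a ≠ 0 := fun h => by
  have h1 := norm_zchar a
  rw [h, norm_zero] at h1
  exact zero_ne_one h1

/-- `χ(Σ_i f i) = Π_i χ(f i)`. [folklore] -/
theorem zchar_sum {ι : Type*} (s : Finset ι) (f : ι → ZMod q) :
    zchar q (∑ i ∈ s, f i) = ∏ i ∈ s, zchar q (f i) := by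
  classical
  induction s using Finset.induction_on with
  | empty => simp [zchar_zero]
  | insert i s hi ih => rw [Finset.sum_insert hi, Finset.prod_insert hi, zchar_add, ih]

/-- `χ(-a) = conj χ(a)`. [folklore] -/
theorem zchar_neg_eq_conj (a : ZMod q) : zchar q (-a) = starRingEnd ℂ (zchar q a) := by
  have h1 : zchar q a * zchar q (-a) = 1 := by rw [← zchar_add, add_neg_cancel, zchar_zero]
  have h2 : zchar q a * starRingEnd ℂ (zchar q a) = 1 := by
    rw [Complex.mul_conj, Complex.normSq_eq_norm_sq, norm_zchar]; simp
  exact mul_left_cancel₀ (zchar_ne_zero a) (h1.trans h2.symm)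

/-- `χ(a) = 1 ↔ a = 0` (`ζ_q` is a PRIMITIVE `q`-th root of unity). [folklore] -/
theorem zchar_eq_one_iff {a : ZMod q} : zchar q a = 1 ↔ a = 0 := by
  refine ⟨fun h => ?_, fun h => by rw [h, zchar_zero]⟩
  have hdvd : q ∣ a.val := ((isPrimitiveRoot_rootζ (NeZero.ne q)).pow_eq_one_iff_dvd a.val).1 h
  exact (ZMod.val_eq_zero a).1 (Nat.eq_zero_of_dvd_of_lt hdvd (ZMod.val_lt a))

/-- `χ` is injective. [folklore] -/
theorem zchar_injective : Function.Injective (zchar q) := fun a b h => by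
  have h2 : zchar q (a - b) * zchar q b = 1 * zchar q b := by rw [← zchar_add, sub_add_cancel, h, one_mul]
  exact sub_eq_zero.1 (zchar_eq_one_iff.1 (mul_right_cancel₀ (zchar_ne_zero b) h2))

/-- `Re χ(a) = (χ(a) + χ(-a)) / 2` as complex numbers. [folklore] -/
theorem ofReal_re_zchar (a : ZMod q) : (((zchar q a).re : ℝ) : ℂ) = (zchar q a + zchar q (-a)) / 2 := by
  rw [Complex.re_eq_add_conj, zchar_neg_eq_conj]

/-- **Character sums killed by a shift.**  If `L : A → ℤ/q` is additive on a finite abelian group `A`, `φ : A → ℂ` is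
invariant under translation by `x₀`, and `L x₀ ≠ 0`, then `Σ_x χ(L x) φ(x) = 0`: the substitution `x ↦ x + x₀`
multiplies the sum by `χ(L x₀) ≠ 1`. [folklore] -/
theorem sum_zchar_mul_eq_zero_of_shift {A : Type*} [AddCommGroup A] [Fintype A] (L : A → ZMod q)
    (hL : ∀ x y, L (x + y) = L x + L y) (φ : A → ℂ) (x₀ : A) (hφ : ∀ x, φ (x + x₀) = φ x) (h0 : L x₀ ≠ 0) :
    ∑ x, zchar q (L x) * φ x = 0 := by
  have hshift : zchar q (L x₀) * ∑ x, zchar q (L x) * φ x = ∑ x, zchar q (L x) * φ x := by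
    rw [Finset.mul_sum]
    exact Fintype.sum_equiv (Equiv.addRight x₀) _ _ fun x => by
      simp only [Equiv.coe_addRight, hL, hφ, zchar_add]; ring
  have hne : zchar q (L x₀) ≠ 1 := fun h => h0 (zchar_eq_one_iff.1 h)
  have h : (zchar q (L x₀) - 1) * ∑ x, zchar q (L x) * φ x = 0 := by rw [sub_mul, one_mul, hshift, sub_self]
  rcases mul_eq_zero.1 h with h | h
  · exact absurd (sub_eq_zero.1 h) hne
  · exact h

/-- The unweighted case: `Σ_x χ(L x) = 0` as soon as `L x₀ ≠ 0` for some `x₀`. [folklore] -/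
theorem sum_zchar_eq_zero_of_shift {A : Type*} [AddCommGroup A] [Fintype A] (L : A → ZMod q)
    (hL : ∀ x y, L (x + y) = L x + L y) (x₀ : A) (h0 : L x₀ ≠ 0) : ∑ x, zchar q (L x) = 0 := by
  have h := sum_zchar_mul_eq_zero_of_shift L hL (fun _ => 1) x₀ (fun _ => rfl) h0
  simpa only [mul_one] using h

end ZChar

/-! ## PART B — THE `q`-TORSION GRID `(ℤ/q)^p` OF THE MAXIMAL TORUS OF `SU(p+1)`, PARAMETRISED ADDITIVELY -/

section Torus

variable {p q : ℕ}

/-- The diagonal entries `(χ(x_0), …, χ(x_{p-1}), χ(-Σ_i x_i))` of the torus element with torsion coordinates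
`x ∈ (ℤ/q)^p`. [folklore] -/
noncomputable def torVec (x : Fin p → ZMod q) : Fin (p + 1) → ℂ :=
  Fin.snoc (fun i => zchar q (x i)) (zchar q (-∑ i, x i))

/-- The first `p` entries. [folklore] -/
@[simp] theorem torVec_castSucc (x : Fin p → ZMod q) (i : Fin p) : torVec x i.castSucc = zchar q (x i) := by
  simp [torVec]

/-- The last entry. [folklore] -/
@[simp] theorem torVec_last (x : Fin p → ZMod q) : torVec x (Fin.last p) = zchar q (-∑ i, x i) := by
  simp [torVec]

variable [NeZero q]

/-- All entries have norm one. [folklore] -/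
theorem norm_torVec (x : Fin p → ZMod q) (i : Fin (p + 1)) : ‖torVec x i‖ = 1 := by
  cases i using Fin.lastCases with
  | last => rw [torVec_last, norm_zchar]
  | cast j => rw [torVec_castSucc, norm_zchar]

/-- The entries multiply to one. [folklore] -/
theorem prod_torVec (x : Fin p → ZMod q) : ∏ i, torVec x i = 1 := by
  rw [Fin.prod_univ_castSucc]
  simp only [torVec_castSucc, torVec_last]
  rw [← zchar_sum, ← zchar_add, add_neg_cancel, zchar_zero]

/-- Additivity of the entries: `torVec (x + y) = torVec x * torVec y`. [folklore] -/
theorem torVec_add (x y : Fin p → ZMod q) : torVec (x + y) = torVec x * torVec y := by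
  funext i
  cases i using Fin.lastCases with
  | last =>
    rw [Pi.mul_apply, torVec_last, torVec_last, torVec_last, ← zchar_add]
    congr 1
    simp only [Pi.add_apply, Finset.sum_add_distrib, neg_add]
  | cast j => rw [Pi.mul_apply, torVec_castSucc, torVec_castSucc, torVec_castSucc, Pi.add_apply, zchar_add]

/-- THE TORUS ELEMENT `D(x) = diag(χ(x_0), …, χ(x_{p-1}), χ(-Σ x_i)) ∈ SU(p+1)`, `x ∈ (ℤ/q)^p` (norm-one entries with
product one; tree `diagonal_mem_specialUnitaryGroup_iff`). [folklore] -/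
noncomputable def torDiag (x : Fin p → ZMod q) : Matrix.specialUnitaryGroup (Fin (p + 1)) ℂ :=
  ⟨Matrix.diagonal (torVec x), (diagonal_mem_specialUnitaryGroup_iff _).2 ⟨norm_torVec x, prod_torVec x⟩⟩

/-- Its matrix. [folklore] -/
theorem coe_torDiag (x : Fin p → ZMod q) :
    ((torDiag x : Matrix.specialUnitaryGroup (Fin (p + 1)) ℂ) : Matrix (Fin (p + 1)) (Fin (p + 1)) ℂ)
      = Matrix.diagonal (torVec x) := rfl

/-- **`D` is a homomorphism `(ℤ/q)^p → SU(p+1)`**: `D(x + y) = D(x) D(y)`. [folklore] -/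
theorem torDiag_add (x y : Fin p → ZMod q) : torDiag (x + y) = torDiag x * torDiag y := by
  apply Subtype.ext
  show Matrix.diagonal (torVec (x + y)) = Matrix.diagonal (torVec x) * Matrix.diagonal (torVec y)
  rw [Matrix.diagonal_mul_diagonal, torVec_add]
  rfl

/-- `D` is injective (`χ` is). [folklore] -/
theorem torDiag_injective : Function.Injective (torDiag (p := p) (q := q)) := fun x y h => by
  have hv : torVec x = torVec y := Matrix.diagonal_injective (congrArg Subtype.val h)
  funext i
  exact zchar_injective (by rw [← torVec_castSucc x i, ← torVec_castSucc y i, hv])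

/-- The trace of `D(x)`: `Σ_{i<p} χ(x_i) + χ(-Σ_i x_i)`. [folklore] -/
theorem trace_coe_torDiag (x : Fin p → ZMod q) :
    ((torDiag x : Matrix.specialUnitaryGroup (Fin (p + 1)) ℂ) : Matrix (Fin (p + 1)) (Fin (p + 1)) ℂ).trace
      = ∑ i, zchar q (x i) + zchar q (-∑ i, x i) := by
  rw [coe_torDiag, Matrix.trace_diagonal, Fin.sum_univ_castSucc]
  simp only [torVec_castSucc, torVec_last]

end Torus

/-! ## PART C — LATTICE CONFIGURATIONS PARAMETRISED ADDITIVELY: EVERY HOLONOMY IS `D` OF A `ℤ`-LINEAR FORM -/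

section Grid

variable {d : ℕ} {G : Type*} [Group G] {A : Type*} [AddCommGroup A] {ι : Type*} [Fintype ι]

/-- `[e = E₀] ∈ {0, 1} ⊂ ℤ`. [folklore] -/
def edgeCoeff (E₀ e : ZdEdge d) : ℤ := if e = E₀ then 1 else 0

/-- The signed coefficient of a dart relative to the edge `E₀`: `+1` along `E₀` forwards, `-1` backwards, `0` along any
other edge. [folklore] -/
noncomputable def dartCoeff (E₀ : ZdEdge d) (e : (zdGraph d).Dart) : ℤ :=
  if (dartStep e).2 then edgeCoeff E₀ (dartStep e).1 else -edgeCoeff E₀ (dartStep e).1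

/-- The signed number of traversals of `E₀` by a walk (its winding coefficient at `E₀`). [folklore] -/
noncomputable def walkCoeff (E₀ : ZdEdge d) {x y : Fin d → ℤ} (w : (zdGraph d).Walk x y) : ℤ :=
  (w.darts.map (dartCoeff E₀)).sum

/-- THE GRID CONFIGURATION `U_s`: the loaded edge `E_j` carries `D(s_j)`, every other edge carries `D(0) = 1`; written
uniformly as `U_s(e) = D(Σ_j [e = E_j] • s_j)`. [folklore] -/
def gridCfg (E : ι → ZdEdge d) (D : A → G) (s : ι → A) : LGConfig d G :=
  fun e => D (∑ j, edgeCoeff (E j) e • s j)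

variable {E : ι → ZdEdge d} {D : A → G}

/-- An additive-to-multiplicative map sends `0` to `1` … [folklore] -/
theorem map_zero_eq_one_of_map_add (hD : ∀ a b, D (a + b) = D a * D b) : D 0 = 1 := by
  have h := hD 0 0
  rw [add_zero] at h
  exact mul_left_cancel (h.symm.trans (mul_one _).symm)

/-- … and negatives to inverses. [folklore] -/
theorem map_neg_eq_inv_of_map_add (hD : ∀ a b, D (a + b) = D a * D b) (a : A) : D (-a) = (D a)⁻¹ :=
  eq_inv_of_mul_eq_one_right (by rw [← hD, add_neg_cancel, map_zero_eq_one_of_map_add hD])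

/-- The dart holonomy of `U_s` is `D(Σ_j dartCoeff_j • s_j)`. [folklore] -/
theorem dartHolonomy_gridCfg (hD : ∀ a b, D (a + b) = D a * D b) (s : ι → A) (e : (zdGraph d).Dart) :
    dartHolonomy (gridCfg E D s) e = D (∑ j, dartCoeff (E j) e • s j) := by
  unfold dartHolonomy dartCoeff
  cases (dartStep e).2
  · simp [gridCfg, Finset.sum_neg_distrib, map_neg_eq_inv_of_map_add hD]
  · simp [gridCfg]

/-- Along a list of darts the holonomy of `U_s` is `D` of the summed coefficients. [folklore] -/
theorem prod_map_dartHolonomy_gridCfg (hD : ∀ a b, D (a + b) = D a * D b) (s : ι → A) :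
    ∀ l : List ((zdGraph d).Dart),
      (l.map (dartHolonomy (gridCfg E D s))).prod = D (∑ j, (l.map (dartCoeff (E j))).sum • s j)
  | [] => by simp [map_zero_eq_one_of_map_add hD]
  | e :: l => by
    rw [List.map_cons, List.prod_cons, dartHolonomy_gridCfg hD, prod_map_dartHolonomy_gridCfg hD s l, ← hD]
    congr 1
    simp only [List.map_cons, List.sum_cons, add_zsmul, Finset.sum_add_distrib]

/-- **The holonomy of `U_s` along any walk `w` is `D(Σ_j walkCoeff_{E_j}(w) • s_j)`** — `D` of a `ℤ`-linear form in
the edge variables whose coefficients are the winding coefficients of `w`. [folklore] -/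
theorem walkHolonomy_gridCfg (hD : ∀ a b, D (a + b) = D a * D b) (s : ι → A) {x y : Fin d → ℤ}
    (w : (zdGraph d).Walk x y) : walkHolonomy (gridCfg E D s) w = D (∑ j, walkCoeff (E j) w • s j) :=
  prod_map_dartHolonomy_gridCfg hD s w.darts

/-- Hence a single-loop observable at `U_s` is `f(D(Σ_j m_j • s_j))`, `m_j = walkCoeff_{E_j}(ℓ)`. [folklore] -/
theorem wilsonLoopObs_gridCfg (hD : ∀ a b, D (a + b) = D a * D b) (f : G → ℝ) {x : Fin d → ℤ}
    (w : (zdGraph d).Walk x x) (s : ι → A) :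
    wilsonLoopObs f w (gridCfg E D s) = f (D (∑ j, walkCoeff (E j) w • s j)) := by
  show f (walkHolonomy _ w) = _
  rw [walkHolonomy_gridCfg hD]

end Grid

end Summit.QuantumFields.BalabanUV.InfiniteVolume.LoopProductGrid
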